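import Literature.MathematicalPhysics.QuantumLattice.LatticeGaugeDLRLimitPointsProofs
import HarnessLib

/-!
# Weak subsequential limits of probability measures on the lattice gauge configuration space

Helper file of crux `FibreToTorus` (stmt-QuantumFields-16244), line `Sketch` (energy/tangent programme,
step G3 of the converse "kink of the pressure ⇒ two phases with different energies"): every sequence of
probability measures on the compact metrisable configuration space `LGConfig d G = (edges ℤ^d → G)` of a
compact Hausdorff second-countable group `G` has a subsequence converging, on all bounded continuous
observables, to a probability measure (Prokhorov / Riesz–Markov compactness).  The tree's
`infiniteVolumeLimitPoints_nonempty_holds` is the same extraction for the special sequence of torus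
states; here it is done for an arbitrary sequence.

## Proof

`LGConfig d G` is a countable product of compact second-countable Hausdorff spaces, hence compact,
second countable and Hausdorff, and its product σ-algebra is Borel (`Pi.borelSpace`).  Mathlib's
`ProbabilityMeasure (LGConfig d G)` (topology of weak convergence) is then compact
(`instCompactSpaceProbabilityMeasure`) and metrisable (Lévy–Prokhorov), so `IsCompact.tendsto_subseq`
on `isCompact_univ` extracts a convergent subsequence, and
`ProbabilityMeasure.tendsto_iff_forall_integral_tendsto` turns weak convergence into convergence of the
integrals of every bounded continuous `F` (packaged as a `BoundedContinuousFunction` by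
`BoundedContinuousFunction.ofNormedAddCommGroup`).
-/

noncomputable section

open MeasureTheory Filter Topology
open Literature.MathematicalPhysics.QuantumLattice (LGConfig ZdEdge)

namespace Summit.QuantumFields.YangMills.Theorems.FibreToTorus

/-- **Weak subsequential limits exist** (registered helper sub-goal `kink_exists_subseq_weakLimit`, G3):
for a compact Hausdorff second-countable `G`, every sequence `P k` of probability measures on
`LGConfig d G = (edges ℤ^d → G)` has a subsequence `P (φ k)` and a probability measure `μ` with
`∫ F dP(φ k) → ∫ F dμ` for every bounded continuous `F : LGConfig d G → ℝ` — compactness and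
metrisability of the space of probability measures on a compact metrisable space (Prokhorov /
Riesz–Markov; Seiler LNP 159 Ch. 2, Chatterjee arXiv:1803.01950 §2 "by compactness"). -/
theorem kink_exists_subseq_weakLimit : ∀ (d : ℕ) (G : Type) [TopologicalSpace G] [CompactSpace G] [T2Space G] [SecondCountableTopology G] [MeasurableSpace G] [BorelSpace G] (P : ℕ → MeasureTheory.Measure (LGConfig d G)), (∀ k, MeasureTheory.IsProbabilityMeasure (P k)) → ∃ (φ : ℕ → ℕ) (μ : MeasureTheory.Measure (LGConfig d G)), StrictMono φ ∧ MeasureTheory.IsProbabilityMeasure μ ∧ ∀ F : LGConfig d G → ℝ, Continuous F → (∃ C : ℝ, ∀ U, |F U| ≤ C) → Filter.Tendsto (fun k => ∫ U, F U ∂P (φ k)) Filter.atTop (nhds (∫ U, F U ∂μ)) := by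
  -- adapted from `Literature.MathematicalPhysics.QuantumLattice.infiniteVolumeLimitPoints_nonempty_holds`
  -- (Literature/MathematicalPhysics/QuantumLattice/LatticeGaugeDLRLimitPointsProofs.lean)
  intro d G _ _ _ _ _ _ P hP
  let Q : ℕ → ProbabilityMeasure (LGConfig d G) := fun k => ⟨P k, hP k⟩
  obtain ⟨μ, -, φ, hφ, hlim⟩ :=
    (isCompact_univ (X := ProbabilityMeasure (LGConfig d G))).tendsto_subseq
      fun n => Set.mem_univ (Q n)
  refine ⟨φ, (μ : Measure (LGConfig d G)), hφ, inferInstance, fun F hFc hFb => ?_⟩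
  obtain ⟨C, hC⟩ := hFb
  let Fb : BoundedContinuousFunction (LGConfig d G) ℝ :=
    BoundedContinuousFunction.ofNormedAddCommGroup F hFc C
      (fun U => by simpa [Real.norm_eq_abs] using hC U)
  have key : Tendsto (fun k : ℕ => ∫ U, Fb U ∂(Q (φ k) : Measure (LGConfig d G))) atTop
      (𝓝 (∫ U, Fb U ∂(μ : Measure (LGConfig d G)))) :=
    (ProbabilityMeasure.tendsto_iff_forall_integral_tendsto.1 hlim) Fb
  exact key

end Summit.QuantumFields.YangMills.Theorems.FibreToTorus

end
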